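import Summits.FinalStateConjecture.FinalStateConjecture.Theses.PhaseMixingCapture
import Summits.FinalStateConjecture.FinalStateConjecture.Theses.SwallowTheDatum
import Summits.FinalStateConjecture.FinalStateConjecture.Theorems.SwallowTheDatumTargetGlue
import Literature.Geometry.Lorentzian.IPlusRegular

/-!
# Crux WeakCosmicCensorshipMGHD (stmt-FinalStateConjecture-9952) — ideator 1, round 1: first lemmas

Sketch file of the crux-ideate seat `planner-cruxidea-stmt-FinalStateConjecture-9952-1-0`.
Three typed statements (all `def … : Prop`, no sorry) and two sorry-free glue theorems:

* `KerrShieldedScriComplete` — the shielding predicate of `SwallowTheDatum.KerrShieldedSettles`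
  verbatim, with the conclusion cut down to the censorship clause
  `∀ MGHD, HasCompleteNullInfinity` (no final-state decomposition, no exhaustive charts).
* `wcc_of_burial` — PROVED: `ParametricKerrBurial → KerrShieldedScriComplete → MGHDExists →
  PhaseMixingCapture.WeakCosmicCensorshipMGHD` (card `shield-only-censorship`).
* `CensorshipDescends` — sojourn-completeness of `𝓘⁺` descends along an isometric embedding of
  developments over a data map `Φ : N → X` with co-compact range (cards 1 and 2).
* `hasCompleteNullInfinity_of_exists_maximal` — PROVED from `CensorshipDescends` (`Φ = id`): one
  maximal development with complete `𝓘⁺` gives it for all maximal developments.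
* `completeNullInfinityInvariant_of_descends` — PROVED: `CensorshipDescends` implies the standing
  disprover's §3 hypothesis `CompleteNullInfinityInvariant` (isometry-invariance of complete `𝓘⁺`).
* `HypersurfaceDevelopmentsEmbed` — generalised exterior ignorance: developments of the data
  induced on an acausal spacelike hypersurface INSIDE an MGHD embed into it (card
  `stability-certified-burial`).
-/

namespace Summit.FinalStateConjecture.FinalStateConjecture.Cruxes.WeakCosmicCensorshipMGHD.Sketch1

open scoped Manifold ContDiff Topology
open Set Literature.Geometry.Lorentzian
open Summit.FinalStateConjecture.FinalStateConjecture.Theses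

/-- **Kerr-shielded admissible data are censored.** The hypothesis is, character for character,
the shielding predicate of `SwallowTheDatum.KerrShieldedSettles` / the conclusion of
`SwallowTheDatum.ParametricKerrBurial` (outside a compact set the datum is the bent exact Kerr
slice `t* = T_{M,a}(r)` over `{r > r₁}`, `r₋ < r₁ < r₊`); the conclusion is ONLY the censorship
clause of the summit: every maximal vacuum Cauchy development has complete `𝓘⁺` (sojourn form).
Intended proof: `SubdataDevelopmentsEmbed` embeds the exact Kerr region
`W = D({t* = T(r), r > r₁})` into the MGHD; `CensorshipDescends` reduces to the sojourn bound for
exact Kerr null geodesics above the bent slice (entry radius into `C⁺(B₀)` is `≥ (R_p + R₀)/2`,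
`|dr/dλ| ≤ C·E`, exit from `W` only through `r = r₁`). -/
def KerrShieldedScriComplete : Prop :=
  ∀ [Literature.Geometry.Lorentzian.Kerr.Facts] (X : Type) [TopologicalSpace X] [ChartedSpace Literature.Geometry.Lorentzian.E3 X] [IsManifold (𝓡 3) ((⊤ : ℕ∞) : WithTop ℕ∞) X] [T2Space X] [SecondCountableTopology X] [ConnectedSpace X], ∀ D ∈ Literature.Geometry.Lorentzian.admissibleVacuumData X, (∃ (M a r₁ : ℝ) (hM : 0 ≤ M) (T : ℝ → ℝ) (φ : Literature.Geometry.Lorentzian.Kerr.slice a r₁ → X) (ψ : Literature.Geometry.Lorentzian.Kerr.slice a r₁ → Literature.Geometry.Lorentzian.Kerr.region a r₁) (ν : Literature.Geometry.Lorentzian.NormalField 𝓘(ℝ, Literature.Geometry.Lorentzian.E4) ψ), |a| < M ∧ Literature.Geometry.Lorentzian.Kerr.rMinus M a < r₁ ∧ r₁ < Literature.Geometry.Lorentzian.Kerr.rPlus M a ∧ T = (fun r : ℝ => Real.smoothTransition (r / (4 * M) - 1) * (((M) / Real.sqrt ((M) ^ 2 - (a) ^ 2)) * (Literature.Geometry.Lorentzian.Kerr.rPlus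 M a * Real.log (r - Literature.Geometry.Lorentzian.Kerr.rPlus M a) - Literature.Geometry.Lorentzian.Kerr.rMinus M a * Real.log (r - Literature.Geometry.Lorentzian.Kerr.rMinus M a)) - ((M) / Real.sqrt ((M) ^ 2 - (a) ^ 2)) * (Literature.Geometry.Lorentzian.Kerr.rPlus M a * Real.log ((4 * M) - Literature.Geometry.Lorentzian.Kerr.rPlus M a) - Literature.Geometry.Lorentzian.Kerr.rMinus M a * Real.log ((4 * M) - Literature.Geometry.Lorentzian.Kerr.rMinus M a)))) ∧ IsCompact (Set.range φ)ᶜ ∧ Topology.IsOpenEmbedding φ ∧ ContMDiff 𝓘(ℝ, Literature.Geometry.Lorentzian.E3) (𝓡 3) ((⊤ : ℕ∞) : WithTop ℕ∞) φ ∧ (∀ y : Literature.Geometry.Lorentzian.Kerr.slice a r₁, (ψ y : Literature.Geometry.Lorentzian.E4) = Literature.Geometry.Lorentzian.E4.ofTimeSpace (T (Literature.Geometry.Lorentzian.Kerr.radius a (Literature.Geometry.Lorentzian.E4.ofTimeSpace 0 (y : Literature.Geometry.Lorentzian.E3)))) (y : Literature.Geometry.Lorentzian.E3)) ∧ (Literature.Geometry.Lorentzian.Kerr.smoothMetric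 M a r₁).IsSpacelikeImmersion 𝓘(ℝ, Literature.Geometry.Lorentzian.E3) ψ ∧ (Literature.Geometry.Lorentzian.Kerr.smoothMetric M a r₁).IsFutureUnitNormal 𝓘(ℝ, Literature.Geometry.Lorentzian.E3) ((Literature.Geometry.Lorentzian.Kerr.timeOrientation M a r₁ hM).ofLE le_top) ψ ν ∧ (∀ y : Literature.Geometry.Lorentzian.Kerr.slice a r₁, Literature.Geometry.Lorentzian.pullbackBilin (I := 𝓡 3) (I' := 𝓘(ℝ, Literature.Geometry.Lorentzian.E3)) φ (D).h.inner y = Literature.Geometry.Lorentzian.pullbackBilin (I := 𝓘(ℝ, Literature.Geometry.Lorentzian.E4)) (I' := 𝓘(ℝ, Literature.Geometry.Lorentzian.E3)) ψ (Literature.Geometry.Lorentzian.Kerr.smoothMetric M a r₁).val y) ∧ (∀ [(Literature.Geometry.Lorentzian.Kerr.smoothMetric M a r₁).HasLeviCivita] (y : Literature.Geometry.Lorentzian.Kerr.slice a r₁), (Literature.Geometry.Lorentzian.pullbackBilin (I := 𝓡 3) (I' := 𝓘(ℝ, Literature.Geometry.Lorentzian.E3)) φ (D).k y).toLinearMap₁₂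 = (Literature.Geometry.Lorentzian.Kerr.smoothMetric M a r₁).secondFundamentalForm 𝓘(ℝ, Literature.Geometry.Lorentzian.E3) ψ ν y)) → ∀ 𝒟 : Literature.Geometry.Lorentzian.VacuumCauchyDevelopment D, 𝒟.IsMaximal → Summit.FinalStateConjecture.HasCompleteNullInfinity 𝒟.toCauchyDevelopment

/-- `KerrShieldedSettles` (route SwallowTheDatum, stmt-10054) trivially implies the censorship-only
version. -/
theorem scriComplete_of_settles (h : SwallowTheDatum.KerrShieldedSettles) :
    KerrShieldedScriComplete := by
  unfold SwallowTheDatum.KerrShieldedSettles at h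
  unfold KerrShieldedScriComplete
  intro _ X _ _ _ _ _ _ D hD hS 𝒟 h𝒟
  exact (h X D hD hS 𝒟 h𝒟).1

/-- **Card `shield-only-censorship`, glue (PROVED).** Burial + censorship of shielded data + MGHD
existence give the crux `PhaseMixingCapture.WeakCosmicCensorshipMGHD`: unfold the typed
genericity (`IsChristodoulouGeneric … 1 = HasCodimAtLeastIn 𝓓 {d ∈ 𝓓 | ¬P d} 1`), take the
burial family through the exceptional datum, and observe that every `F c`, `c ≠ 0`, satisfies
`P` (so is not exceptional). `Kerr.Facts` is the tree's `SwallowTheDatum.kerrFacts`. -/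
theorem wcc_of_burial
    (hB : SwallowTheDatum.ParametricKerrBurial) (hS : KerrShieldedScriComplete)
    (hM : SwallowTheDatum.MGHDExists) :
    PhaseMixingCapture.WeakCosmicCensorshipMGHD := by
  unfold PhaseMixingCapture.WeakCosmicCensorshipMGHD
  unfold SwallowTheDatum.ParametricKerrBurial at hB
  unfold KerrShieldedScriComplete at hS
  unfold SwallowTheDatum.MGHDExists at hM
  intro X _ _ _ _ _ _
  unfold InitialDataSet.IsChristodoulouGeneric InitialDataSet.HasCodimAtLeastIn
  intro d hd
  haveI : Kerr.Facts := Theorems.SwallowTheDatum.kerrFacts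
  obtain ⟨F, hF, h0, hinj, hadm, hshield⟩ := hB X d hd.1
  refine ⟨F, hF, h0, hinj, hadm, fun c hc hmem ↦ hmem.2 ?_⟩
  exact ⟨hM X (F c) (hadm c), fun 𝒟 h𝒟 ↦ hS X (F c) (hadm c) (hshield c hc) 𝒟 h𝒟⟩

/-- **Censorship descends along shielded embeddings of developments.** If a vacuum Cauchy
development `𝒟'` of data on `N` embeds isometrically (time-orientation preserving, open) into a
Cauchy development `𝒟` of data on `X` over a data map `Φ : N → X` (`χ ∘ ι' = ι ∘ Φ`) whose
range has COMPACT complement, and `𝒟'` has complete `𝓘⁺` in the sojourn form, then so has `𝒟`: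
take `B₀ := Φ(B₀')`, `B₁ := (range Φ)ᶜ ∪ Φ(B₁')`; a normalised null ray of `𝒟` from `ι(Φ q)`
restricts (pull back by `χ` on the component of `γ⁻¹(range χ)` containing `0`) to a normalised
null ray of `𝒟'` from `ι' q` (`dχ ν' = ν` by uniqueness of the future unit normal), and
`χ(J⁺_{𝒟'}(ι' B₀')) ⊆ J⁺_{𝒟}(ι Φ B₀')`, so sojourn times only grow. The case `N = X`, `Φ = id`
is "one good maximal development suffices". Size M (geodesic bookkeeping over `Geodesic`,
`NullInfinity`). -/
def CensorshipDescends : Prop :=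
  ∀ (X : Type) [TopologicalSpace X] [ChartedSpace E3 X] [IsManifold (𝓡 3) ((⊤ : ℕ∞) : WithTop ℕ∞) X]
    [ConnectedSpace X] (D : InitialDataSet (𝓡 3) X) (𝒟 : VacuumCauchyDevelopment D)
    (N : Type) [TopologicalSpace N] [ChartedSpace E3 N] [IsManifold (𝓡 3) ((⊤ : ℕ∞) : WithTop ℕ∞) N]
    [ConnectedSpace N] (D' : InitialDataSet (𝓡 3) N) (𝒟' : VacuumCauchyDevelopment D')
    (Φ : N → X) (χ : 𝒟'.carrier → 𝒟.carrier),
    IsCompact (range Φ)ᶜ →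
    ContMDiff (𝓡 4) (𝓡 4) ((⊤ : ℕ∞) : WithTop ℕ∞) χ → Topology.IsOpenEmbedding χ →
    𝒟'.metric.IsIsometricImmersion 𝒟.metric.toPseudoRiemannianMetric χ →
    𝒟'.timeOrientation.PreservesTimeOrientation χ 𝒟.timeOrientation →
    χ ∘ 𝒟'.embed = 𝒟.embed ∘ Φ →
    Summit.FinalStateConjecture.HasCompleteNullInfinity 𝒟'.toCauchyDevelopment →
    Summit.FinalStateConjecture.HasCompleteNullInfinity 𝒟.toCauchyDevelopment

/-- **One maximal development with complete `𝓘⁺` suffices** (PROVED from `CensorshipDescends`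
with `N = X`, `Φ = id`): maximal developments embed into each other, and censorship descends. This
discharges the `∀ MGHD` quantifier of the crux once one MGHD is certified. -/
theorem hasCompleteNullInfinity_of_exists_maximal (hCD : CensorshipDescends)
    {X : Type} [TopologicalSpace X] [ChartedSpace E3 X] [IsManifold (𝓡 3) ((⊤ : ℕ∞) : WithTop ℕ∞) X]
    [ConnectedSpace X] {D : InitialDataSet (𝓡 3) X} (𝒟₀ 𝒟 : VacuumCauchyDevelopment D)
    (h₀ : Summit.FinalStateConjecture.HasCompleteNullInfinity 𝒟₀.toCauchyDevelopment)
    (h𝒟 : 𝒟.IsMaximal) :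
    Summit.FinalStateConjecture.HasCompleteNullInfinity 𝒟.toCauchyDevelopment := by
  obtain ⟨ψ, hψ, hopen, hiso, hτ, hcomp⟩ := h𝒟 𝒟₀
  refine hCD X D 𝒟 X D 𝒟₀ id ψ ?_ hψ hopen hiso hτ ?_ h₀
  · simp
  · simpa using hcomp

/-- **Generalised exterior ignorance (developments of an interior hypersurface embed).** Let `𝒟`
be a MAXIMAL vacuum Cauchy development of `(X, D)` and `σ : N → 𝒟.carrier` a smooth embedding of
a connected `3`-manifold as an ACAUSAL spacelike hypersurface, with future unit normal `νσ`,
inducing the data `Dσ = (σ^* g, K_{νσ})` on `N`. Then every vacuum Cauchy development `𝒟''` of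
`(N, Dσ)` embeds into `𝒟` over `σ` (`χ ∘ ι'' = σ`). The case `σ = ι ∘ Φ` is
`SwallowTheDatum.SubdataDevelopmentsEmbed`; the general case is what lets a censorship certificate
be read off a RE-SLICED hypersurface inside the MGHD (card `stability-certified-burial`: the
Kerr–Schild leaf `t* = 0` below the admissible bent slice). Intended proof: maximal common
development `U` of `Dσ` in `(𝒟'', 𝒟)` (contains the domain of dependence of `σ(N)`, is causally
convex in `𝒟''` because `σ(N)` is Cauchy there); if `U ≠ 𝒟''`, either some boundary point of `U`
has a limit in `𝒟` (local geometric uniqueness extends `U` — contradiction) or none does (the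
gluing `𝒟 ∪_U 𝒟''` is Hausdorff, vacuum, and `ι(X)` is still met exactly once by every endless
timelike curve — contradicting maximality of `𝒟` via rigidity of self-embeddings). Size L
(Choquet-Bruhat–Geroch / Ringström Ch. 16 / Sbierski 2016). -/
def HypersurfaceDevelopmentsEmbed : Prop :=
  ∀ (X : Type) [TopologicalSpace X] [ChartedSpace E3 X] [IsManifold (𝓡 3) ((⊤ : ℕ∞) : WithTop ℕ∞) X]
    [T2Space X] [SecondCountableTopology X] [ConnectedSpace X]
    (D : InitialDataSet (𝓡 3) X) (𝒟 : VacuumCauchyDevelopment D), 𝒟.IsMaximal →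
    ∀ (N : Type) [TopologicalSpace N] [ChartedSpace E3 N] [IsManifold (𝓡 3) ((⊤ : ℕ∞) : WithTop ℕ∞) N]
      [T2Space N] [SecondCountableTopology N] [ConnectedSpace N]
      (Dσ : InitialDataSet (𝓡 3) N) (σ : N → 𝒟.carrier) (νσ : NormalField (𝓡 4) σ),
      Manifold.IsSmoothEmbedding (𝓡 3) (𝓡 4) ((⊤ : ℕ∞) : WithTop ℕ∞) σ →
      𝒟.metric.IsFutureUnitNormal (𝓡 3) 𝒟.timeOrientation σ νσ →
      (∀ y : N, pullbackBilin (I := 𝓡 4) (I' := 𝓡 3) σ 𝒟.metric.val y = Dσ.h.inner y) →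
      (∀ [𝒟.metric.toPseudoRiemannianMetric.HasLeviCivita] (y : N),
        𝒟.metric.toPseudoRiemannianMetric.secondFundamentalForm (𝓡 3) σ νσ y = Dσ.kBilin y) →
      𝒟.metric.IsAcausal 𝒟.timeOrientation (range σ) →
      ∀ 𝒟'' : VacuumCauchyDevelopment Dσ, ∃ χ : 𝒟''.carrier → 𝒟.carrier,
        ContMDiff (𝓡 4) (𝓡 4) ((⊤ : ℕ∞) : WithTop ℕ∞) χ ∧ Topology.IsOpenEmbedding χ ∧
        𝒟''.metric.IsIsometricImmersion 𝒟.metric.toPseudoRiemannianMetric χ ∧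
        𝒟''.timeOrientation.PreservesTimeOrientation χ 𝒟.timeOrientation ∧ χ ∘ 𝒟''.embed = σ

/-- The standing disprover's §3 hypothesis `CompleteNullInfinityInvariant`
(`Cruxes/WeakCosmicCensorshipMGHD/Disproof.lean`, copied verbatim up to the spelling `𝓡 3` of the
model): complete `𝓘⁺` is invariant under isometry of vacuum Cauchy developments. Under it (and the
PROVED MGHD uniqueness `mghd_unique_cauchy`) the disprover shows the crux's `∃ ∧ ∀` bundling is the
`∃`-form (`mem_wccSet_iff_exists`). -/
def CompleteNullInfinityInvariant : Prop :=
  ∀ (X : Type) [TopologicalSpace X] [ChartedSpace E3 X]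
    [IsManifold (𝓡 3) ((⊤ : ℕ∞) : WithTop ℕ∞) X] [ConnectedSpace X]
    (D : InitialDataSet (𝓡 3) X) (𝒟₁ 𝒟₂ : VacuumCauchyDevelopment D),
    𝒟₁.toCauchyDevelopment.IsIsometricTo 𝒟₂.toCauchyDevelopment →
    Summit.FinalStateConjecture.HasCompleteNullInfinity 𝒟₁.toCauchyDevelopment →
    Summit.FinalStateConjecture.HasCompleteNullInfinity 𝒟₂.toCauchyDevelopment

/-- **`CensorshipDescends` discharges the disprover's hypothesis** (PROVED): an isometry of
developments is in particular an embedding over `Φ = id` (`IsIsometricTo.embedsInto`). -/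
theorem completeNullInfinityInvariant_of_descends (hCD : CensorshipDescends) :
    CompleteNullInfinityInvariant := by
  intro X _ _ _ _ D 𝒟₁ 𝒟₂ hiso h₁
  obtain ⟨ψ, hψ, hopen, hiso', hτ, hcomp⟩ := CauchyDevelopment.IsIsometricTo.embedsInto hiso
  refine hCD X D 𝒟₂ X D 𝒟₁ id ψ ?_ hψ hopen hiso' hτ ?_ h₁
  · simp
  · simpa using hcomp

end Summit.FinalStateConjecture.FinalStateConjecture.Cruxes.WeakCosmicCensorshipMGHD.Sketch1
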